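import Literature.AlgebraicGeometry.Villamayor2007.PurelyRamifiedLocus
import HarnessLib

/-!
# Villamayor 2007, Thm. 4.13 / Thm. 4.11 (ii) (one monic polynomial): the elimination algebra `R̄_f ⊂ S[W]`
# lies INSIDE every differential Rees algebra `𝒢 ⊂ S[Z][W]` containing the `Δ^e(f)·W^{b−e}` — PROVED

O. E. Villamayor U., *Hypersurface singularities in positive characteristic*, Adv. Math. **213** (2007)
687–733 = arXiv:math/0606796 [Villamayor2007]; locators «p00NN Lnn» = chunk · line of the held arXiv text
(`lit read paper:arxiv-math_0606796`, chunks p0021–p0023 re-read before typing). Sequel of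
`ChangeOfVariables.lean` (`specialize_taylor`, `specialize_scale`), `DegreePreserving.lean`
(`specialize_mem_of_forall_mem`, `specialize_C_comp`) and `PurelyRamifiedLocus.lean` (`hasseDeriv_map`).
Campaign `res-hironaka` (D-0089), ladder rung LIT-6. PROOF file: theorems only, no definitions, no named facts;
nothing of Hironaka's 2017 manuscript is referred to.

## What is proved

* **4.7 p0021 L52–L58 (display (2corth)).** «as `𝒢_x` is a differential Rees algebra relative to the structure
  field `k`, it is also closed by differentials relative to `S`; and hence `S[Z][{Δ^α(f_{c_i})W^{n_i−α} / f_{c_i}W^{n_i}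
  ∈ ℱ, and 0 ≤ α < c_i}] ⊂ 𝒢_x`» — this is the HYPOTHESIS on `𝒢` below (an `S[Z]`-subalgebra of `S[Z][W]`
  containing the weighted Hasse derivatives `Δ^e(f)·W^{b−e}`, `0 ≤ e ≤ b − 1`, of `f = monicOf a`).
* **Thm. 4.13 p0023 L83–L100** «The elimination algebra `R_𝒢 (⊂ S[W])` is a graded subalgebra of `𝒢_x (⊂ R[W])`,
  via the inclusion `S[W] ⊂ R[W]` … `R̄_{f_{c₁},…,f_{c_r}}` is generated by elements which are weighted homogeneous
  on elements on `{Δ^e(f_{c_i})W^{c_i−e}, 0 ≤ e ≤ c_i − 1}`; and hence by homogeneous elements in `𝒢`» (= Thm. 4.11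
  (ii) p0022 L104–L106 «`R_𝒢` is included in `𝒢̄ ∩ S[W]`», proof p0022 L120–p0023 L13), ONE POLYNOMIAL (`r = 1`):
  - `specialize_hasseDeriv` — THE MECHANISM, for every `G ∈ R̄_b`: evaluating `G` at the vector of Hasse
    derivatives `(Δ^{b−1}(f), …, Δ^0(f))` of `f ∈ S[Z]` (in place of the coefficients `(a₁, …, a_b)`) gives the
    CONSTANT polynomial `G(a)` («`G_m` can be expressed as a polynomial in `{F^{(j)}_{c_i}}`», p0022 L131–L137; it is
    `specialize_taylor` at the universal translation `Z₁ = Z − Z`, since `coeff_e f(T + Z) = Δ^e(f)(Z)`);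
  - `monomial_C_specialize_mem_adjoin` — with the weights: `G(a)·W^r ∈ k[Δ^e(f)·W^{b−e} : e < b]` for `G ∈ [R̄_b]_r`;
  - **`monomial_C_mem_of_mem_elimIdeal` / `map_C_mem_of_mem_elimAlgebra`** (Thm. 4.13, `r = 1`): for every
    `S[Z]`-subalgebra `𝒢 ⊂ S[Z][W]` containing all `Δ^e(f)·W^{b−e}` (`0 ≤ e < b`): `h·W^r ∈ 𝒢` for `h ∈ I_r(f)`, and
    the whole elimination algebra `R̄_f ⊂ S[W]` maps into `𝒢` under `S[W] ⊂ S[Z][W]`; same for `ℋ_f`.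
  NOT typed: the multi-polynomial algebras `R̄_{f_{c₁},…,f_{c_r}}` (multi-block specialization, see
  `EliminationAlgebra.lean` TODO), Thm. 4.11 (i), (iii)–(v) (integrality of `𝒢̄` over `R_𝒢`, `Sing`).

## References

* O. E. Villamayor U., Adv. Math. 213 (2007) 687–733 = arXiv:math/0606796: 4.7, Thm. 4.11, Thm. 4.13.
  [Villamayor2007]
-/

noncomputable section

open scoped Polynomial

namespace Literature.AlgebraicGeometry.Villamayor2007

open MvPolynomial

universe u v w

section DiffAlgebra

variable (k : Type v) [CommRing k] {S : Type w} [CommRing S] [Algebra k S] {b : ℕ}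

/-- The coefficient vector of `f(T + Z) ∈ S[Z][T]` is the vector of Hasse derivatives `(Δ^{b−1−i}(f))_i` of `f`
(Def. 1.2 «`Tay(F(Z)) = Σ Δ^r(F(Z))T^r`», p0006 L54–L65). [cite: Villamayor2007, Def. 1.2 p0006 L54–L65] -/
theorem coeffVec_taylor_X_map_C (f : S[X]) :
    coeffVec b (Polynomial.taylor (Polynomial.X : S[X]) (f.map (Polynomial.C : S →+* S[X]))) =
      fun i : Fin b => Polynomial.hasseDeriv (b - 1 - (i : ℕ)) f := by
  funext i
  show (Polynomial.taylor (Polynomial.X : S[X]) (f.map (Polynomial.C : S →+* S[X]))).coeff (b - 1 - (i : ℕ)) = _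
  rw [Polynomial.taylor_coeff, ← hasseDeriv_map, Polynomial.eval_map, Polynomial.eval₂_C_X]

/-- `monicOf` commutes with `C : S → S[Z]` (constants). [cite: Villamayor2007, Def. 1.2 p0006 L67–L68] -/
theorem monicOf_map_C (a : Fin b → S) :
    (monicOf a).map (Polynomial.C : S →+* S[X]) = monicOf (fun i : Fin b => Polynomial.C (a i)) := by
  simp [monicOf, Polynomial.map_sum]

/-- **The mechanism of Thm. 4.13** [Villamayor 2007, Thm. 4.11 (ii) proof p0022 L131–L137 «`G_m` can be expressed
as a polynomial in `{F^{(j)}_{c_i}}` … (`F^{(j)}_{c_i}` defined in terms of differential operators)»]: for every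
`G ∈ R̄_b` and `f = monicOf a ∈ S[Z]`, the value of `G` at the Hasse-derivative vector `(Δ^{b−1}(f), …, Δ^0(f))`
(i.e. at the coefficients of `f(T + Z)`, the universal translation `Z₁ = Z − Z`) is the CONSTANT `G(a) ∈ S ⊂ S[Z]`.
[cite: Villamayor2007, Thm. 4.11 (ii) p0022 L120–L137] -/
theorem specialize_hasseDeriv (a : Fin b → S) {G : MvPolynomial (Fin b) k} (hG : G ∈ univElimOne (Fin b) k) :
    specialize k (fun i : Fin b => Polynomial.hasseDeriv (b - 1 - (i : ℕ)) (monicOf a))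
        ⟨G, univElimOne_le_symmetricSubalgebra hG⟩ =
      Polynomial.C (specialize k a ⟨G, univElimOne_le_symmetricSubalgebra hG⟩) := by
  rw [← specialize_C_comp, ← coeffVec_taylor_X_map_C, monicOf_map_C a]
  exact specialize_taylor k (fun i : Fin b => Polynomial.C (a i)) Polynomial.X hG

/-- With the weights [Villamayor 2007, Thm. 4.13 proof p0023 L96–L100 «generated by elements which are weighted
homogeneous on elements on `{Δ^e(f_{c_i})W^{c_i−e}, 0 ≤ e ≤ c_i − 1}`»]: for `G ∈ [R̄_b]_r`,
`G(a)·W^r ∈ k[Δ^e(f)·W^{b−e} : 0 ≤ e ≤ b − 1] ⊂ S[Z][W]` (here `Δ^{b−1−i}(f)·W^{i+1}`, `i < b`).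
[cite: Villamayor2007, Thm. 4.13 p0023 L83–L100] -/
theorem monomial_C_specialize_mem_adjoin (a : Fin b → S) {G : MvPolynomial (Fin b) k} {r : ℕ}
    (hG : G ∈ univElimPiece (Fin b) k (fun _ : Fin b => ()) r) :
    Polynomial.monomial r (Polynomial.C (specialize k a ⟨G, univElimOne_le_symmetricSubalgebra hG.1⟩)) ∈
      Algebra.adjoin k (Set.range fun i : Fin b =>
        Polynomial.monomial ((i : ℕ) + 1) (Polynomial.hasseDeriv (b - 1 - (i : ℕ)) (monicOf a))) := by
  have hmem := specialize_mem_of_forall_mem k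
    (Algebra.adjoin k (Set.range fun i : Fin b =>
      Polynomial.monomial ((i : ℕ) + 1) (Polynomial.hasseDeriv (b - 1 - (i : ℕ)) (monicOf a))))
    (fun i : Fin b => Polynomial.C (Polynomial.hasseDeriv (b - 1 - (i : ℕ)) (monicOf a)) *
      Polynomial.X ^ ((i : ℕ) + 1))
    (fun i => by
      rw [Polynomial.C_mul_X_pow_eq_monomial]
      exact Algebra.subset_adjoin ⟨i, rfl⟩)
    ⟨G, univElimOne_le_symmetricSubalgebra hG.1⟩
  rwa [specialize_scale k _ Polynomial.X hG, specialize_C_comp, specialize_hasseDeriv k a hG.1, mul_comm,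
    Polynomial.C_mul_X_pow_eq_monomial] at hmem

variable {k}

/-- **Thm. 4.13 (one monic polynomial), on generators** [Villamayor 2007, Thm. 4.13 p0023 L83–L88 «The elimination
algebra `R_𝒢 (⊂ S[W])` is a graded subalgebra of `𝒢_x (⊂ R[W])`, via the inclusion `S[W] ⊂ R[W]`», with 4.7
p0021 L52–L58 «`S[Z][{Δ^α(f_{c_i})W^{n_i−α}}] ⊂ 𝒢_x`» as hypothesis]: if `𝒢 ⊂ S[Z][W]` is an `S[Z]`-subalgebra
containing `Δ^e(f)·W^{b−e}` for `0 ≤ e ≤ b − 1` (`f = monicOf a`), then `h·W^r ∈ 𝒢` for every `h ∈ I_r(f)`.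
[cite: Villamayor2007, Thm. 4.13 p0023 L83–L100] -/
theorem monomial_C_mem_of_mem_elimIdeal (a : Fin b → S) (𝒢 : Subalgebra S[X] S[X][X])
    (h𝒢 : ∀ i : Fin b,
      Polynomial.monomial ((i : ℕ) + 1) (Polynomial.hasseDeriv (b - 1 - (i : ℕ)) (monicOf a)) ∈ 𝒢)
    {r : ℕ} {h : S} (hh : h ∈ elimIdeal k a r) :
    Polynomial.monomial r (Polynomial.C h) ∈ 𝒢 := by
  -- the generators `G(a)`, `G ∈ [R̄_b]_r`
  have hgen : ∀ x ∈ elimGen k a r, Polynomial.monomial r (Polynomial.C x) ∈ 𝒢 := by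
    rintro _ ⟨H, rfl⟩
    have hle : Algebra.adjoin k (Set.range fun i : Fin b =>
        Polynomial.monomial ((i : ℕ) + 1) (Polynomial.hasseDeriv (b - 1 - (i : ℕ)) (monicOf a))) ≤
        𝒢.restrictScalars k :=
      Algebra.adjoin_le (by rintro _ ⟨i, rfl⟩; exact h𝒢 i)
    exact hle (monomial_C_specialize_mem_adjoin k a H.2)
  -- `S`-linear combinations: `(s·x)·W^r = C s • (x·W^r)`
  rw [elimIdeal] at hh
  induction hh using Submodule.span_induction with
  | mem x hx => exact hgen x hx
  | zero =>
    rw [map_zero, map_zero]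
    exact 𝒢.zero_mem
  | add x y _ _ hx hy =>
    rw [map_add, map_add]
    exact 𝒢.add_mem hx hy
  | smul s x _ hx =>
    rw [smul_eq_mul, map_mul, ← smul_eq_mul, ← Polynomial.smul_monomial]
    exact 𝒢.smul_mem hx (Polynomial.C s)

/-- **Thm. 4.13 (one monic polynomial): `R̄_f ⊂ 𝒢` via `S[W] ⊂ S[Z][W]`** [Villamayor 2007, Thm. 4.13 p0023 L83–L88;
Thm. 4.11 (ii) p0022 L104–L106 «The elimination algebra `R_𝒢` is included in `𝒢̄ ∩ S[W]`»]: every element of the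
elimination algebra `R̄_f = ⊕ I_r W^r ⊂ S[W]`, read in `S[Z][W]`, lies in any `S[Z]`-subalgebra `𝒢` containing the
weighted Hasse derivatives `Δ^e(f)·W^{b−e}`, `0 ≤ e ≤ b − 1`. [cite: Villamayor2007, Thm. 4.13 p0023 L83–L100] -/
theorem map_C_mem_of_mem_elimAlgebra (a : Fin b → S) (𝒢 : Subalgebra S[X] S[X][X])
    (h𝒢 : ∀ i : Fin b,
      Polynomial.monomial ((i : ℕ) + 1) (Polynomial.hasseDeriv (b - 1 - (i : ℕ)) (monicOf a)) ∈ 𝒢)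
    {q : S[X]} (hq : q ∈ elimAlgebra k a) :
    q.map (Polynomial.C : S →+* S[X]) ∈ 𝒢 := by
  rw [mem_elimAlgebra_iff] at hq
  rw [(q.map (Polynomial.C : S →+* S[X])).as_sum_range_C_mul_X_pow]
  refine 𝒢.sum_mem fun r _ => ?_
  rw [Polynomial.C_mul_X_pow_eq_monomial, Polynomial.coeff_map]
  exact monomial_C_mem_of_mem_elimIdeal a 𝒢 h𝒢 (hq r)

/-- `ℋ_f ⊂ 𝒢` likewise (Thm. 4.13 for the computable subalgebra, `ℋ_f ⊆ R̄_f`).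
[cite: Villamayor2007, Thm. 4.13 p0023 L83–L100] -/
theorem map_C_mem_of_mem_hElimAlgebra (a : Fin b → S) (𝒢 : Subalgebra S[X] S[X][X])
    (h𝒢 : ∀ i : Fin b,
      Polynomial.monomial ((i : ℕ) + 1) (Polynomial.hasseDeriv (b - 1 - (i : ℕ)) (monicOf a)) ∈ 𝒢)
    {q : S[X]} (hq : q ∈ hElimAlgebra k a) :
    q.map (Polynomial.C : S →+* S[X]) ∈ 𝒢 :=
  map_C_mem_of_mem_elimAlgebra a 𝒢 h𝒢 (hElimAlgebra_le_elimAlgebra a hq)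

/-- The smallest such `𝒢`: the `S[Z]`-subalgebra GENERATED by the `Δ^e(f)·W^{b−e}` (the one-polynomial instance of
4.7's `S[Z][{Δ^α(f)W^{b−α}}]`) already contains `R̄_f`. [cite: Villamayor2007, 4.7 p0021 L52–L58] -/
theorem map_C_mem_adjoin_hasseDeriv_of_mem_elimAlgebra (a : Fin b → S) {q : S[X]} (hq : q ∈ elimAlgebra k a) :
    q.map (Polynomial.C : S →+* S[X]) ∈
      Algebra.adjoin S[X] (Set.range fun i : Fin b =>
        Polynomial.monomial ((i : ℕ) + 1) (Polynomial.hasseDeriv (b - 1 - (i : ℕ)) (monicOf a))) :=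
  map_C_mem_of_mem_elimAlgebra a
    (Algebra.adjoin S[X] (Set.range fun i : Fin b =>
      Polynomial.monomial ((i : ℕ) + 1) (Polynomial.hasseDeriv (b - 1 - (i : ℕ)) (monicOf a))))
    (fun i => Algebra.subset_adjoin ⟨i, rfl⟩) hq

end DiffAlgebra

end Literature.AlgebraicGeometry.Villamayor2007

end
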